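import Mathlib
import Summits.AtomisticToContinuum.HydrodynamicLimit.Theorems.InformationPercolationEngineKickFairRelEquilibriumMesoDefs
import Summits.AtomisticToContinuum.HydrodynamicLimit.Theorems.InformationPercolationEngineCollisionRateWindowCountMeasurable
import Literature.Analysis.FluidPDE.HardSphereCollisionEnumeration
import Literature.Analysis.FluidPDE.HardSphereFlowJointMeasurable
import Literature.Analysis.FluidPDE.HardSphereCollisionRecordMeasurable
import Literature.Analysis.FluidPDE.LoadedCollisionRecordMeasurable
import HarnessLib

/-!
# `InformationPercolationEngine.KickFairRelEquilibriumMeso` — Borel plumbing of the typed past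
(crux stmt-AtomisticToContinuum-15177, line `Sketch`, card `two-time-pinch`, stub M `stub_pastMeasurable`)

Helper file (`--supports stmt-AtomisticToContinuum-15177`) proving the registered stub `stub_pastMeasurable` of
the lead's checked skeleton for the crux
`Summit.AtomisticToContinuum.HydrodynamicLimit.Theses.InformationPercolationEngine.KickFairRelEquilibriumMeso`,
line `Sketch`, over the line vocabulary
`Summits/…/Theorems/InformationPercolationEngineKickFairRelEquilibriumMesoDefs.lean` (`Flow`, `Phase`, `Past`,
`past`, `kick`, `cnt`). The statement is spelled exactly as registered.

Content. The crux centres each kick at `κ = condExp` given `MeasurableSpace.comap (fun z => past Φ r z i n)`,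
which is Mathlib's junk `0` unless that comap σ-algebra is below the Borel one, i.e. unless the typed past is a
measurable function of the initial datum; the glue also needs the kick datum and the windowed collision count to
be measurable. A `HardSphereFlow` only records measurability of each time-`t` map `Φ_t`; the collision times,
partners, flight starts and records of the orbit are `sInf`/`sSup`-enumerations over a continuum of times. This
file is the PORT to `HardSphereFlow` on the flat torus (any dimension `d`, any diameter `ε`, everything restricted
to the good set `Φ.good`, where orbits are hard-sphere trajectories) of
`Literature/Analysis/FluidPDE/LoadedCollisionRecordMeasurable.lean` (itself a port from the hard-sphere flow to
loaded flows), REUSING its model-free lemmas: the hitting-time lemmas `measurable_nextTimeAfter_setOf_eq_zero`,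
`measurable_sSup_insert_setOf_eq_zero` (next / last zero of a function continuous in time and measurable in the
parameter), the participation gauge `contactGauge` (`contactGauge_eq_zero_iff`, `continuous_contactGauge`,
`measurable_contactGauge`), `measurable_partner`, `measurable_select`; together with
the joint measurability of the flow on `Φ.good × ℝ` (`HardSphereFlow.measurable_flow_prod_torus`) and the
measurable structure of collision records (`HardSphereCollisionRecord.measurable_ofConfig₂_torus`,
`measurable_impactVec`, `measurable_preVel`) and Mathlib's `measurable_from_prod_countable_left`,
`measurable_of_restrict_of_restrict_compl`, `measurable_to_countable'`:

* `continuous_orbitGauge` / `measurable_orbitGauge` / `collisionTimesOf_eq_setOf_orbitGauge` — along a good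
  orbit the collision times of `i` are the zero set of `t ↦ contactGauge (x(t))`, continuous in `t`
  (positions of a hard-sphere trajectory are continuous, the minimal-image distance is continuous) and
  measurable in `z` for fixed `t`;
* `measurable_nthCollisionTimeOf_good`, `measurable_flightStart_good`, `measurable_flow_at_good`,
  `measurable_nthContactConfig_good`, `measurable_nthPartnerOf_good`, `measurable_partnerFlightStart_good`,
  `measurable_coarsePastOf_good`, `measurable_nthRecordOf_good` — the flow-level maps of
  `HardSphereCollisionRecord.lean` restricted to the good set are measurable;
* `measurable_ite_ncard_collisionTimesOf_inter_Ioc` — the `ℕ`-valued count of collision times of `k` in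
  `(0, w]`, cut to the good set, is measurable (super-level sets
  `measurableSet_good_inter_le_ncard_collisionTimesOf` + `measurable_to_countable'`, exactly as
  `CollisionRate.measurable_ite_ncard_collisionTimesOf_inter_Ico` does for `[s, t)`);
* `measurable_past`, `measurable_kick` and the registered `stub_pastMeasurable` (`d = Fin 3`, `N + 1` spheres of
  diameter `hsDiameter σ N`; the hypothesis `0 < σ` is not needed).

No new definitions; no dynamics beyond the structure fields of `HardSphereFlow`.
-/

noncomputable section

open MeasureTheory Set Filter Topology
open scoped ENNReal Classical

namespace Summit.AtomisticToContinuum.HydrodynamicLimit.Theorems.KickFairRelEquilibriumMesoLine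

open Literature.Analysis.FluidPDE Literature.MathematicalPhysics.KineticTheory

section Torus

variable {d : Type*} [Fintype d] {N : ℕ} {ε : ℝ} (Φ : HardSphereFlow (Torus.geometry d) ε N)

/-! ## The participation gauge along a good orbit -/

/-- The minimal-image distance `‖sepVec x y‖` of the flat torus is jointly continuous (any diameter; this is the
field `continuous_norm_sepVec` of `Torus.isHardSphereRegular_geometry` without its hypothesis `ε < 1/2`).
[folklore] -/
theorem continuous_norm_torus_sepVec :
    Continuous fun p : UnitAddTorus d × UnitAddTorus d => ‖(Torus.geometry d).sepVec p.1 p.2‖ :=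
  Torus.continuous_norm_reprSym.comp (continuous_fst.sub continuous_snd)

/-- Along the orbit of a good datum the participation gauge of `i` is continuous in time (positions of a
hard-sphere trajectory are continuous). Ported from `LoadedSphereFlow.continuous_orbitGauge`. [folklore] -/
theorem continuous_orbitGauge (i : Fin N) (z : Φ.good) :
    Continuous fun t : ℝ =>
      contactGauge (Torus.geometry d) ε i fun k => (Φ.flow t (z : Config N d (UnitAddTorus d)) k).1 :=
  (continuous_contactGauge (G := Torus.geometry d) (ε := ε) continuous_norm_torus_sepVec i).comp
    (continuous_pi fun k => (Φ.isTrajectory _ z.2).pos_continuous k)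

/-- At a fixed time the participation gauge of `i` along the orbit is measurable in the (good) datum.
Ported from `LoadedSphereFlow.measurable_orbitGauge`. [folklore] -/
theorem measurable_orbitGauge (i : Fin N) (t : ℝ) :
    Measurable fun z : Φ.good =>
      contactGauge (Torus.geometry d) ε i fun k => (Φ.flow t (z : Config N d (UnitAddTorus d)) k).1 :=
  (measurable_contactGauge (G := Torus.geometry d) (ε := ε) Torus.measurable_geometry_sepVec i).comp
    ((measurable_pi_lambda _ fun k => (measurable_pi_apply k).fst).comp
      ((Φ.measurable_flow t).comp measurable_subtype_coe))

/-- **The collision times of `i` along a good orbit are the zero set of the gauge.** Ported from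
`LoadedSphereFlow.collisionTimesOf_eq_setOf_orbitGauge`. [folklore] -/
theorem collisionTimesOf_eq_setOf_orbitGauge (i : Fin N) (z : Φ.good) :
    collisionTimesOf (Torus.geometry d) ε (fun t => Φ.flow t (z : Config N d (UnitAddTorus d))) i =
      {t | contactGauge (Torus.geometry d) ε i
        (fun k => (Φ.flow t (z : Config N d (UnitAddTorus d)) k).1) = 0} := by
  ext t
  rw [mem_collisionTimesOf, mem_setOf_eq]
  exact (contactGauge_eq_zero_iff ((Φ.isTrajectory _ z.2).mem t) i).symm

/-! ## Collision times, flight starts, partners, coarse past and records on the good set -/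

/-- **The `n`-th collision time of `i` is measurable on the good set**: inductively, the next zero of the gauge
after a measurable time (`measurable_nextTimeAfter_setOf_eq_zero`). Ported from
`LoadedSphereFlow.measurable_nthCollisionTimeOf`. [folklore] -/
theorem measurable_nthCollisionTimeOf_good (i : Fin N) (n : ℕ) :
    Measurable fun z : Φ.good => Φ.nthCollisionTimeOf i n (z : Config N d (UnitAddTorus d)) := by
  have hc := fun z : Φ.good => continuous_orbitGauge Φ i z
  have hm := fun t : ℝ => measurable_orbitGauge Φ i t
  induction n with
  | zero =>
    have h : (fun z : Φ.good => Φ.nthCollisionTimeOf i 0 (z : Config N d (UnitAddTorus d))) =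
        fun z : Φ.good => nextTimeAfter {t | contactGauge (Torus.geometry d) ε i
          (fun k => (Φ.flow t (z : Config N d (UnitAddTorus d)) k).1) = 0} ((fun _ => (0 : ℝ)) z) := by
      funext z
      rw [HardSphereFlow.nthCollisionTimeOf_eq, Literature.Analysis.FluidPDE.nthCollisionTimeOf,
        nthTimeAfter_zero, collisionTimesOf_eq_setOf_orbitGauge]
    rw [h]
    exact measurable_nextTimeAfter_setOf_eq_zero hc hm measurable_const
  | succ n ih =>
    have h : (fun z : Φ.good => Φ.nthCollisionTimeOf i (n + 1) (z : Config N d (UnitAddTorus d))) =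
        fun z : Φ.good => nextTimeAfter {t | contactGauge (Torus.geometry d) ε i
          (fun k => (Φ.flow t (z : Config N d (UnitAddTorus d)) k).1) = 0}
          (Φ.nthCollisionTimeOf i n (z : Config N d (UnitAddTorus d))) := by
      funext z
      rw [HardSphereFlow.nthCollisionTimeOf_eq, HardSphereFlow.nthCollisionTimeOf_eq,
        Literature.Analysis.FluidPDE.nthCollisionTimeOf, Literature.Analysis.FluidPDE.nthCollisionTimeOf,
        nthTimeAfter_succ, collisionTimesOf_eq_setOf_orbitGauge]
    rw [h]
    exact measurable_nextTimeAfter_setOf_eq_zero hc hm ih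

/-- **The flight start of `j` at the `n`-th collision time of `i` is measurable on the good set** (the last
zero of the gauge of `j` before a measurable time, `measurable_sSup_insert_setOf_eq_zero`). Ported from
`LoadedSphereFlow.measurable_flightStart_good`. [folklore] -/
theorem measurable_flightStart_good (i j : Fin N) (n : ℕ) :
    Measurable fun z : Φ.good =>
      flightStart (Torus.geometry d) ε (fun t => Φ.flow t (z : Config N d (UnitAddTorus d))) 0 j
        (Φ.nthCollisionTimeOf i n (z : Config N d (UnitAddTorus d))) := by
  have h : (fun z : Φ.good =>
      flightStart (Torus.geometry d) ε (fun t => Φ.flow t (z : Config N d (UnitAddTorus d))) 0 j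
        (Φ.nthCollisionTimeOf i n (z : Config N d (UnitAddTorus d)))) =
      fun z : Φ.good => sSup (insert 0 ({t | contactGauge (Torus.geometry d) ε j
        (fun k => (Φ.flow t (z : Config N d (UnitAddTorus d)) k).1) = 0} ∩
          Ioo 0 (Φ.nthCollisionTimeOf i n (z : Config N d (UnitAddTorus d))))) := by
    funext z
    rw [flightStart, collisionTimesOf_eq_setOf_orbitGauge]
  rw [h]
  exact measurable_sSup_insert_setOf_eq_zero (fun z => continuous_orbitGauge Φ j z)
    (fun t => measurable_orbitGauge Φ j t) 0 (measurable_nthCollisionTimeOf_good Φ i n)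

/-- **The flow at a measurable random time is measurable on the good set** (joint measurability of the flow on
`Φ.good × ℝ`, `HardSphereFlow.measurable_flow_prod_torus`). Ported from `LoadedSphereFlow.measurable_flow_at`.
[folklore] -/
theorem measurable_flow_at_good {s : Φ.good → ℝ} (hs : Measurable s) :
    Measurable fun z : Φ.good => Φ.flow (s z) (z : Config N d (UnitAddTorus d)) :=
  Φ.measurable_flow_prod_torus.comp (measurable_id.prodMk hs)

/-- **The configuration at the `n`-th collision of `i` is measurable on the good set.** Ported from
`LoadedSphereFlow.measurable_nthContactConfig`. [folklore] -/
theorem measurable_nthContactConfig_good (i : Fin N) (n : ℕ) :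
    Measurable fun z : Φ.good =>
      Φ.flow (Φ.nthCollisionTimeOf i n (z : Config N d (UnitAddTorus d))) (z : Config N d (UnitAddTorus d)) :=
  measurable_flow_at_good Φ (measurable_nthCollisionTimeOf_good Φ i n)

/-- **The `n`-th partner of `i` is measurable on the good set** (the partner is a measurable function of the
configuration, `measurable_partner`). Ported from `LoadedSphereFlow.measurable_nthPartnerOf`. [folklore] -/
theorem measurable_nthPartnerOf_good (i : Fin N) (n : ℕ) :
    Measurable fun z : Φ.good => Φ.nthPartnerOf i n (z : Config N d (UnitAddTorus d)) :=
  (measurable_partner (G := Torus.geometry d) (ε := ε) Torus.measurable_geometry_sepVec i).comp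
    (measurable_nthContactConfig_good Φ i n)

/-- **The flight start of the partner is measurable on the good set** (a measurable selection among the `N`
flight-start functionals by the measurable partner). Ported from `LoadedSphereFlow.measurable_partnerFlightStartOf`.
[folklore] -/
theorem measurable_partnerFlightStart_good (i : Fin N) (n : ℕ) :
    Measurable fun z : Φ.good =>
      flightStart (Torus.geometry d) ε (fun t => Φ.flow t (z : Config N d (UnitAddTorus d))) 0
        (Φ.nthPartnerOf i n (z : Config N d (UnitAddTorus d)))
        (Φ.nthCollisionTimeOf i n (z : Config N d (UnitAddTorus d))) :=
  measurable_select (fun j => measurable_flightStart_good Φ i j n) (measurable_nthPartnerOf_good Φ i n)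

/-- **The coarse past of the `n`-th collision of `i` is measurable on the good set**, for a measurable cell map
(the coarse-grained configurations at the two flight starts). Ported from `LoadedSphereFlow.measurable_coarsePastOf`.
[folklore] -/
theorem measurable_coarsePastOf_good {C : Type*} [MeasurableSpace C] {q : UnitAddTorus d → C}
    (hq : Measurable q) (i : Fin N) (n : ℕ) :
    Measurable fun z : Φ.good => Φ.coarsePastOf q i n (z : Config N d (UnitAddTorus d)) :=
  ((measurable_coarseConfig hq).comp (measurable_flow_at_good Φ (measurable_flightStart_good Φ i i n))).prodMk
    ((measurable_coarseConfig hq).comp (measurable_flow_at_good Φ (measurable_partnerFlightStart_good Φ i n)))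

/-- **The record of the `n`-th collision of `i` is measurable on the good set**: the record read off a
configuration is jointly measurable in (time, configuration) for each ordered pair
(`HardSphereCollisionRecord.measurable_ofConfig₂_torus`), the pair index ranges over the countable `Fin N`
(`measurable_from_prod_countable_left`), and time, configuration and partner of the `n`-th collision are
measurable on the good set. Ported from `LoadedSphereFlow.measurable_nthRecordOf`. [folklore] -/
theorem measurable_nthRecordOf_good (i : Fin N) (n : ℕ) :
    Measurable fun z : Φ.good => Φ.nthRecordOf i n (z : Config N d (UnitAddTorus d)) := by
  have h2 : Measurable fun p : (ℝ × Config N d (UnitAddTorus d)) × Fin N =>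
      HardSphereCollisionRecord.ofConfig (Torus.geometry d) ε p.1.2 p.1.1 i p.2 :=
    measurable_from_prod_countable_left fun j =>
      HardSphereCollisionRecord.measurable_ofConfig₂_torus ε i j
  exact h2.comp (((measurable_nthCollisionTimeOf_good Φ i n).prodMk
    (measurable_nthContactConfig_good Φ i n)).prodMk (measurable_nthPartnerOf_good Φ i n))

/-- **A map cut to the good set is measurable as soon as it is measurable on the good set** (the good set is
measurable; constant off it). [folklore] -/
theorem measurable_of_measurable_good {β : Type*} [MeasurableSpace β] {f : Config N d (UnitAddTorus d) → β}
    {c : β} (hgood : Measurable fun z : Φ.good => f z) (hoff : ∀ z ∉ Φ.good, f z = c) : Measurable f := by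
  refine measurable_of_restrict_of_restrict_compl Φ.measurableSet_good hgood ?_
  have h : (Φ.goodᶜ).restrict f = fun _ => c := funext fun z => hoff z z.2
  rw [h]
  exact measurable_const

/-! ## The windowed collision count on `(0, w]` -/

/-- **The `ℕ`-valued count of collision times of `k` in `(0, w]`, cut to the good set, is measurable**: its
super-level sets `{m ≤ ·}` are `univ` (`m = 0`) or the events of
`measurableSet_good_inter_le_ncard_collisionTimesOf` (`m ≥ 1`), and an `ℕ`-valued function with measurable
level sets is measurable (`measurable_to_countable'`). The `Ioc` twin of
`CollisionRate.measurable_ite_ncard_collisionTimesOf_inter_Ico`. [folklore] -/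
theorem measurable_ite_ncard_collisionTimesOf_inter_Ioc (k : Fin N) (w : ℝ) :
    Measurable fun z : Config N d (UnitAddTorus d) =>
      if z ∈ Φ.good then (collisionTimesOf (Torus.geometry d) ε (fun u => Φ.flow u z) k ∩ Ioc 0 w).ncard
      else 0 := by
  set g : Config N d (UnitAddTorus d) → ℕ := fun z =>
    if z ∈ Φ.good then (collisionTimesOf (Torus.geometry d) ε (fun u => Φ.flow u z) k ∩ Ioc 0 w).ncard
    else 0 with hg
  -- super-level sets
  have hlev : ∀ m : ℕ, MeasurableSet {z | m ≤ g z} := by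
    intro m
    rcases Nat.eq_zero_or_pos m with rfl | hm
    · have : {z | 0 ≤ g z} = univ := eq_univ_of_forall fun z => Nat.zero_le _
      rw [this]
      exact MeasurableSet.univ
    · have : {z | m ≤ g z} = Φ.good ∩ {z : Config N d (UnitAddTorus d) |
          m ≤ (collisionTimesOf (Torus.geometry d) ε (fun u => Φ.flow u z) k ∩ Ioc 0 w).ncard} := by
        ext z
        simp only [mem_setOf_eq, mem_inter_iff, hg]
        by_cases hz : z ∈ Φ.good
        · rw [if_pos hz]
          exact ⟨fun h => ⟨hz, h⟩, fun h => h.2⟩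
        · rw [if_neg hz]
          constructor
          · intro h; omega
          · intro h; exact absurd h.1 hz
      rw [this]
      exact measurableSet_good_inter_le_ncard_collisionTimesOf Φ k m w
  refine measurable_to_countable' fun m => ?_
  have : g ⁻¹' {m} = {z | m ≤ g z} \ {z | m + 1 ≤ g z} := by
    ext z
    simp only [mem_preimage, mem_singleton_iff, Set.mem_sdiff, mem_setOf_eq]
    omega
  rw [this]
  exact (hlev m).diff (hlev (m + 1))

end Torus

/-! ## The line's typed past, kick datum and count -/

section Line

variable {σ : ℝ} {N : ℕ} (Φ : Flow σ N)

/-- **The typed past is a measurable function of the initial datum** (every mesh `r`, sphere `i`, index `n`):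
on the good set its five components (coarse past, partner, the two flight starts, the collision time) are
measurable, off it the map is constant. [folklore] -/
theorem measurable_past (r : ℝ) (i : Fin (N + 1)) (n : ℕ) : Measurable fun z => past Φ r z i n := by
  have hgood : Measurable fun z : Φ.good => past Φ r (z : Phase N) i n := by
    have h : (fun z : Φ.good => past Φ r (z : Phase N) i n) = fun z : Φ.good =>
        ((Φ.coarsePastOf (Torus.coarseCell r) i n z, Φ.nthPartnerOf i n z),
          (flightStart (Torus.geometry (Fin 3)) (hsDiameter σ N) (fun s => Φ.flow s z) 0 i
              (Φ.nthCollisionTimeOf i n z),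
            flightStart (Torus.geometry (Fin 3)) (hsDiameter σ N) (fun s => Φ.flow s z) 0 (Φ.nthPartnerOf i n z)
              (Φ.nthCollisionTimeOf i n z),
            Φ.nthCollisionTimeOf i n z)) := by
      funext z
      exact if_pos z.2
    rw [h]
    exact ((measurable_coarsePastOf_good Φ (Torus.measurable_coarseCell r) i n).prodMk
      (measurable_nthPartnerOf_good Φ i n)).prodMk
        ((measurable_flightStart_good Φ i i n).prodMk
          ((measurable_partnerFlightStart_good Φ i n).prodMk (measurable_nthCollisionTimeOf_good Φ i n)))
  exact measurable_of_measurable_good Φ hgood fun z hz => if_neg hz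

/-- **The kick datum is a measurable function of the initial datum** (impact vector and pre-collisional
velocities of the measurable `n`-th record on the good set; `0` off it). [folklore] -/
theorem measurable_kick (i : Fin (N + 1)) (n : ℕ) : Measurable (kick Φ i n) := by
  have hgood : Measurable fun z : Φ.good => kick Φ i n (z : Phase N) := by
    have h : (fun z : Φ.good => kick Φ i n (z : Phase N)) = fun z : Φ.good =>
        ((Φ.nthRecordOf i n z).impactVec, (Φ.nthRecordOf i n z).preVel) := by
      funext z
      exact if_pos z.2
    rw [h]
    exact (HardSphereCollisionRecord.measurable_impactVec.comp (measurable_nthRecordOf_good Φ i n)).prodMk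
      (HardSphereCollisionRecord.measurable_preVel.comp (measurable_nthRecordOf_good Φ i n))
  exact measurable_of_measurable_good Φ hgood fun z hz => if_neg hz

/-- **STUB M `stub_pastMeasurable` — Borel plumbing of the typed past** (registered stub of line `Sketch`, card
`two-time-pinch`, crux `InformationPercolationEngine.KickFairRelEquilibriumMeso`). For every reduced diameter
`σ > 0`, every `N`, flow `Φ` of `N + 1` spheres of diameter `hsDiameter σ N` on `𝕋³`, mesh `r`, horizon `τ`,
sphere `i` and index `n`: the typed past `past Φ r · i n` (cut to the good set), the kick datum `kick Φ i n` and
the count `cnt Φ τ · i` of collision times of `i` in `(0, τ]` (cut to the good set) are Borel measurable functions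
of the initial datum — `measurable_past`, `measurable_kick`, `measurable_ite_ncard_collisionTimesOf_inter_Ioc`
(the hypothesis `0 < σ` is not needed). Hence `MeasurableSpace.comap (past Φ r · i n) ≤` Borel and the crux's
centring `κ` is a genuine conditional expectation. [folklore] -/
theorem stub_pastMeasurable :
    ∀ σ : ℝ, 0 < σ → ∀ N : ℕ, ∀ Φ : Flow σ N, ∀ r τ : ℝ, ∀ i : Fin (N + 1), ∀ n : ℕ,
    Measurable (fun z => past Φ r z i n) ∧ Measurable (kick Φ i n) ∧
      Measurable (fun z => if z ∈ Φ.good then cnt Φ τ z i else 0) :=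
  fun _ _ _ Φ r τ i n =>
    ⟨measurable_past Φ r i n, measurable_kick Φ i n, measurable_ite_ncard_collisionTimesOf_inter_Ioc Φ i τ⟩

end Line

end Summit.AtomisticToContinuum.HydrodynamicLimit.Theorems.KickFairRelEquilibriumMesoLine

end
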